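import Summits.BirchSwinnertonDyer.BirchSwinnertonDyer.Theorems.UniversalToricDescentBigRepBoundedInvariants
import Summits.BirchSwinnertonDyer.BirchSwinnertonDyer.Theorems.ErratumRoadFiveBigRepLocalInputs
import Literature.NumberTheory.GaloisRepresentations.ContinuousRepCoeffExtension
import HarnessLib

/-!
# Route `UniversalToricDescent`, crux ♭B `TwinWanFrameAtThreeMult` (stmt-BirchSwinnertonDyer-26062 / 20694), line `membertower`,
# research stub `stub_wanFrameMultCube` — cube-locus port step (P1b) (memo CUBE-LOCUS-PORT-MAP-w2g3): the bounded invariants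
# criterion of (P1a) carried to the erratum's coefficient module `𝒪 ⊗ E[p^∞]` and packaged at the STRICT local index —
# «the constrained local invariants of `M_E|_{G_{K_𝔮}}` are KILLED BY `(C p)^k`» from «the `p`-power torsion of `E(K̄)` fixed by
# the local tower's Galois group is killed by `p^k`» (the shape bsd-stepL's (L1) delivers)

Cell `bsd-wall` (run/shared/lean/pub/bsd-wall/), width seat `bsd-wall-utd-p2-w2` (prover g3, 2026-08-28);
`--supports stmt-BirchSwinnertonDyer-20694 --as helper`; Theses-free; the bounded twins of bsd-stepL's
`ContinuousRep.forall_fixed_primary_eq_zero_extendScalars` (lit `ContinuousRepCoeffExtension`),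
`BigRep.eq_zero_of_forall_fixed_of_torsionBy` and `hloc_extendScalars` (`ErratumRoadFiveBigRepLocalInputs` /
`ErratumRoadFiveIMCDivMemberDivisible`), which are the `k = 0` (vanishing) case.

* §1 `forall_fixed_primary_pow_smul_eq_zero_extendScalars` — `𝒪` free over `R`: if every element of `A` fixed by the `g_i` and
  `p`-power torsion is killed by `p^k`, so is every such element of `𝒪 ⊗_R A` (componentwise in a basis of `𝒪`, as in the
  vanishing case).
* §2 `pow_smul_eq_zero_of_forall_fixed_primaryTorsion` — the same statement moves from `E(K̄)` to `E[p^∞] = PrimaryTorsion`.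
* §3 **`boundedInvariants_extendScalars_localMap_inl`** — at the decomposition index `Sum.inl 𝔮` of defn-ty1's `localMap` /
  `strictSet`: from «every `P ∈ E(K̄)` fixed by all `σ ∈ G_{K_𝔮}` with `κ(σ) = 1` and `p`-power torsion satisfies `p^k P = 0`»
  (`E(K_{∞,w})[p^∞]` killed by `p^k`: (L1) `TateTorsionRigidity.zpTower_branchT_exists_generator_fixed_torsion` once carried from
  `ℚ̄_p` to `K̄`, port step (P1c), NOT here) conclude: every invariant of
  `(AnticyclotomicBigGaloisRep κ (extendScalars 𝒪 (E.primaryTorsionGaloisRep p)))|_{G_{K_𝔮}}` is killed by `(C p)^k` — the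
  annihilator input of `SelmerControlDefect.smul_mem_map_selmer_of_forall_smul_invariants_eq_zero` at the strict place.

HONEST FRAMING: theorems only (no definition, no named fact, no `sorry`); pure algebra/bookkeeping on constructed objects; nothing
about any specific curve is asserted; BSD is not proved by any of this.
References: [Castella2018Erratum] Lemma 2.1 and Remark (2) (p. 2); [Skinner2016PacificMC] §2.6 (2-6-1); bsd-stepL memo §31.2.
-/

noncomputable section

open scoped TensorProduct
open PowerSeries Field IsDedekindDomain NumberField
  Literature.NumberTheory.GaloisRepresentations Literature.NumberTheory.EllipticCurves
  Literature.NumberTheory.EllipticCurves.BigRepModule Literature.NumberTheory.EllipticCurves.BigGaloisRep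
  Summit.BirchSwinnertonDyer.Rank1Residual.X11b.BigRep
  Summit.BirchSwinnertonDyer.BirchSwinnertonDyer.Theorems.UniversalToricDescentBigRepBoundedInvariants

set_option linter.dupNamespace false
set_option autoImplicit false

universe u v w

namespace Summit.BirchSwinnertonDyer.BirchSwinnertonDyer.Theorems.UniversalToricDescentBigRepBoundedInvariantsCurve

/-! ### §1 Coefficient extension `𝒪 ⊗_R A`, `𝒪` free -/

section Coeff

variable {R : Type*} [CommRing R] [TopologicalSpace R] (𝒪 : Type v) [CommRing 𝒪] [Algebra R 𝒪]
  {A : Type w} [AddCommGroup A] [Module R A] [TopologicalSpace A]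
  {G : Type u} [Group G] [TopologicalSpace G]
  [TopologicalSpace 𝒪] [DiscreteTopology A] [ContinuousMul G]

/-- **Fixed `p`-power torsion of `𝒪 ⊗_R A` is killed by `p^k` when that of `A` is** (`𝒪` free over `R`): in an `R`-basis of `𝒪`,
`𝒪 ⊗ A ≅ ⊕ A` equivariantly and componentwise; each component of a fixed `p`-power-torsion `x` is fixed and `p`-power torsion, hence
killed by `p^k`, so `p^k x = 0`. The `k = 0` case is bsd-stepL's `forall_fixed_primary_eq_zero_extendScalars`.
[cite: Skinner2016PacificMC, §2.6 (2-6-1)] [cite: Castella2018Erratum, Lemma 2.1 and Remark (2) (p. 2)] -/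
theorem forall_fixed_primary_pow_smul_eq_zero_extendScalars [Module.Free R 𝒪] (ρ : ContinuousRep G R A)
    {ι' : Type*} (g : ι' → G) {p k : ℕ}
    (hA : ∀ a : A, (∀ i, ρ (g i) a = a) → (∃ j : ℕ, p ^ j • a = 0) → p ^ k • a = 0) :
    ∀ x : CoeffExtension R 𝒪 A, (∀ i, ρ.extendScalars 𝒪 (g i) x = x) →
      (∃ j : ℕ, p ^ j • x = 0) → p ^ k • x = 0 := by
  classical
  -- adapted from lit `ContinuousRep.forall_fixed_torsion_eq_zero_extendScalars` (componentwise in a basis of `𝒪`)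
  let b := Module.Free.chooseBasis R 𝒪
  let e : CoeffExtension R 𝒪 A ≃ₗ[R] (Module.Free.ChooseBasisIndex R 𝒪 →₀ A) :=
    (TensorProduct.congr b.repr (LinearEquiv.refl R A)).trans
      (TensorProduct.finsuppScalarLeft R A _)
  have he : ∀ (γ : G) (x : CoeffExtension R 𝒪 A) (j : Module.Free.ChooseBasisIndex R 𝒪),
      e (ρ.extendScalars 𝒪 γ x) j = ρ γ (e x j) := by
    intro γ x j
    induction x using CoeffExtension.induction_on with
    | zero => rw [map_zero, map_zero, Finsupp.zero_apply, map_zero]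
    | tmul c a =>
      rw [ContinuousRep.extendScalars_apply_tmul]
      change TensorProduct.finsuppScalarLeft R A _ (b.repr c ⊗ₜ[R] ρ γ a) j =
        ρ γ (TensorProduct.finsuppScalarLeft R A _ (b.repr c ⊗ₜ[R] a) j)
      rw [TensorProduct.finsuppScalarLeft_apply_tmul_apply,
        TensorProduct.finsuppScalarLeft_apply_tmul_apply, map_smul]
    | add x y hx hy => simp only [map_add, Finsupp.add_apply, hx, hy]
  rintro x hx ⟨j, hj⟩
  -- every component of `e x` is fixed and `p^j`-torsion, hence killed by `p^k`
  have hcomp : ∀ i', p ^ k • e x i' = 0 := fun i' =>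
    hA (e x i') (fun i => by rw [← he, hx i])
      ⟨j, by rw [← Finsupp.smul_apply, ← map_nsmul, hj, map_zero, Finsupp.zero_apply]⟩
  have hex : e (p ^ k • x) = 0 := Finsupp.ext fun i' => by rw [map_nsmul, Finsupp.smul_apply, hcomp, Finsupp.zero_apply]
  exact e.injective (by rw [hex, map_zero])

end Coeff

/-! ### §2 From `E(K̄)` to `E[p^∞]` -/

section Curve

variable {K : Type u} [Field K] [NumberField K] {p : ℕ} [Fact p.Prime] (W : WeierstrassCurve K)

omit [NumberField K] [Fact p.Prime] in
/-- **«fixed `p`-power torsion killed by `p^k`» passes from `E(K̄)` to `E[p^∞]`** (elements of `PrimaryTorsion` ARE `p`-power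
torsion points; the action and the multiples are the restricted ones). The `k = 0` case is bsd-stepL's
`BigRep.eq_zero_of_forall_fixed_of_torsionBy`. [cite: Castella2018Erratum, Lemma 2.1 and Remark (2) (p. 2)] -/
theorem pow_smul_eq_zero_of_forall_fixed_primaryTorsion {ι : Type*} (g : ι → absoluteGaloisGroup K) {k : ℕ}
    (hk : ∀ P : W.geomPoints, (∀ i, g i • P = P) → (∃ j : ℕ, p ^ j • P = 0) → p ^ k • P = 0)
    (a : PrimaryTorsion (W.geomPoints) p) (ha : ∀ i, g i • a = a) : p ^ k • a = 0 := by
  obtain ⟨j, hj⟩ := a.exists_pow_smul_eq_zero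
  exact PrimaryTorsion.ext (by
    rw [PrimaryTorsion.val_nsmul, PrimaryTorsion.val_zero]
    exact hk (a : W.geomPoints) (fun i => by rw [← PrimaryTorsion.val_gsmul, ha i]) ⟨j, hj⟩)

/-! ### §3 The bounded local input at the strict index, coefficient module `𝒪 ⊗ E[p^∞]` -/

variable (𝒪 : Type u) [CommRing 𝒪] [Algebra ℤ_[p] 𝒪] [TopologicalSpace 𝒪] [TopologicalSpace (PowerSeries 𝒪)]
  [ContinuousSMul (PowerSeries 𝒪) (BigRepModule 𝒪 p (CoeffExtension ℤ_[p] 𝒪 (PrimaryTorsion W.geomPoints p)))]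

/-- **(P1b) — BOUNDED LOCAL INVARIANTS AT THE STRICT PLACE, coefficient module `𝒪 ⊗ E[p^∞]` (`𝒪` free over `ℤ_p`).** If every
`P ∈ E(K̄)` that is fixed by all `σ ∈ G_{K_𝔮}` with `κ(σ) = 1` (the Galois group of the local anticyclotomic tower `K_{∞,w}`) and is
`p`-power torsion satisfies `p^k · P = 0` — «`E(K_{∞,w})[p^∞]` is killed by `p^k`», which at a split multiplicative `p` is
bsd-stepL's Lemma (L1) once carried from `ℚ̄_p` to `K̄` — then every `G_{K_𝔮}`-invariant of the big representation
`M_E = (𝒪 ⊗ E[p^∞]) ⊗ Λ^*(Ψ⁻¹)` restricted along `localMap K (Sum.inl 𝔮)` is killed by `(C p)^k`: the annihilator input of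
THEOREM T♭'s Selmer kernel (`SelmerControlDefect.smul_mem_map_selmer_of_forall_smul_invariants_eq_zero`) at the strict index.
[cite: Castella2018Erratum, Lemma 2.1 and Remark (2) (p. 2)] [cite: SilvermanATAEC1994, Thm. V.3.1 (d) (the source of k)] -/
theorem boundedInvariants_extendScalars_localMap_inl [Module.Free ℤ_[p] 𝒪] (κ : ZpExtension K p)
    (𝔮 : HeightOneSpectrum (𝓞 K)) {k : ℕ}
    (h𝔮 : ∀ P : W.geomPoints,
      (∀ σ : absoluteGaloisGroup (𝔮.adicCompletion K), κ (absGaloisRestrict K (𝔮.adicCompletion K) σ) = 1 →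
        absGaloisRestrict K (𝔮.adicCompletion K) σ • P = P) →
      (∃ j : ℕ, p ^ j • P = 0) → p ^ k • P = 0) :
    ∀ x ∈ (((AnticyclotomicBigGaloisRep κ (ContinuousRep.extendScalars (R := ℤ_[p])
        (G := absoluteGaloisGroup K) (A := PrimaryTorsion W.geomPoints p) 𝒪
        (W.primaryTorsionGaloisRep p))).restrict (localMap K (Sum.inl 𝔮))).toTopRep).ρ.invariants,
      (C (p : 𝒪) : PowerSeries 𝒪) ^ k • x = 0 := by
  refine forall_mem_bigRep_restrict_invariants_C_pow_smul_eq_zero κ.toContinuousMonoidHom _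
    (localMap K (Sum.inl 𝔮)) fun a ha hj ↦ ?_
  -- the `G_{K_𝔮} ∩ ker κ`-fixed `p`-power torsion of `𝒪 ⊗ E[p^∞]` is killed by `p^k`: §1 over §2 over `h𝔮`
  let ι' := {σ : absoluteGaloisGroup (𝔮.adicCompletion K) //
    κ (absGaloisRestrict K (𝔮.adicCompletion K) σ) = 1}
  have hA : ∀ b : PrimaryTorsion W.geomPoints p,
      (∀ i : ι', (W.primaryTorsionGaloisRep p) (absGaloisRestrict K (𝔮.adicCompletion K) i.1) b = b) →
      (∃ j : ℕ, p ^ j • b = 0) → p ^ k • b = 0 := fun b hb _ ↦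
    pow_smul_eq_zero_of_forall_fixed_primaryTorsion W
      (fun i : ι' => absGaloisRestrict K (𝔮.adicCompletion K) i.1)
      (fun P hP hPj => h𝔮 P (fun σ hσ => hP ⟨σ, hσ⟩) hPj) b
      (fun i => by simpa only [WeierstrassCurve.primaryTorsionGaloisRep_apply] using hb i)
  exact forall_fixed_primary_pow_smul_eq_zero_extendScalars 𝒪 (W.primaryTorsionGaloisRep p)
    (fun i : ι' => absGaloisRestrict K (𝔮.adicCompletion K) i.1) hA a
    (fun i => ha i.1 (by rw [ZpExtension.coe_toContinuousMonoidHom]; exact i.2)) hj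

end Curve

end Summit.BirchSwinnertonDyer.BirchSwinnertonDyer.Theorems.UniversalToricDescentBigRepBoundedInvariantsCurve

end
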